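import Mathlib

set_option linter.dupNamespace false

/-!
# Solo-blind seat (MatrixMultiplication), s76 — the group algebra `𝔽₃[𝔽₃^r]` and Olson's element
(HOME `paper/KraftK3.md` §7.17, K3.17.3; CLAIMS c798).  Part 1 of 2 (part 2: `SoloBlindOlsonBerman`).

Door I1⁗ / the Kraft conjecture `(K₃)`.  Work in `A = 𝔽₃[𝔽₃^r]`
(`MonoidAlgebra (ZMod 3) (Multiplicative (Fin r → ZMod 3))`) with `T a` the basis element of `a`,
`Y i = 1 - T eᵢ`, `N = Σ_g T g`, and `J` the ideal spanned by the `Y i` (the augmentation ideal).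
* `soloBlindOB_Y_cube` : `Y i ^ 3 = 0`;  `soloBlindOB_prod_Y_sq` : `∏ i, Y i ^ 2 = N`;
  `soloBlindOB_mul_norm` : every element acts on `N` by a scalar.
* `soloBlindOB_one_sub_T_mem` : every `1 - T a` lies in `J`.
* `soloBlindOB_prod_Y_eq_zero`, `soloBlindOB_prod_Y_of_eq` : a product of `≥ 2r+1` generators `Y` vanishes, a
  product of exactly `2r` generators is `0` or `N` (pigeonhole on the exponents) — i.e. `J^(2r+1) = 0` and
  `J^(2r) ⊆ 𝔽₃·N` on monomials.
* `soloBlindOB_olson_prod_eq_zero`, `soloBlindOB_olson_prod_eq_smul` : hence OLSON'S ELEMENT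
  `∏_{k<m} (1 - T (a k))` is `0` for `m ≥ 2r+1` and a scalar multiple of `N` for `m = 2r`.
No `sorry`, standard axioms.
-/

namespace Summit.MatrixMultiplication.MatrixMultiplication.Theorems

open Finset

section OlsonBerman

/-- The group algebra `𝔽₃[𝔽₃^r]`. -/
abbrev SoloBlindOBAlg (r : ℕ) : Type :=
  MonoidAlgebra (ZMod 3) (Multiplicative (Fin r → ZMod 3))

variable {r : ℕ}

/-- The basis element `T a = [a]` of the group algebra. -/
noncomputable def soloBlindOBT (r : ℕ) (a : Fin r → ZMod 3) : SoloBlindOBAlg r :=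
  MonoidAlgebra.of (ZMod 3) (Multiplicative (Fin r → ZMod 3)) (Multiplicative.ofAdd a)

/-- The generator `Y i = 1 - [eᵢ]` of the augmentation ideal. -/
noncomputable def soloBlindOBY (i : Fin r) : SoloBlindOBAlg r :=
  1 - soloBlindOBT r (Pi.single i 1)

/-- The norm element `N = Σ_g [g]`. -/
noncomputable def soloBlindOBNorm (r : ℕ) : SoloBlindOBAlg r :=
  ∑ g : (Fin r → ZMod 3), soloBlindOBT r g

/-- `3 = 0` in the group algebra over `𝔽₃`. -/
theorem soloBlindOB_three_eq_zero : (3 : SoloBlindOBAlg r) = 0 := by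
  have h : (3 : SoloBlindOBAlg r) = algebraMap (ZMod 3) (SoloBlindOBAlg r) 3 := by
    rw [map_ofNat]
  rw [h]
  have : (3 : ZMod 3) = 0 := by decide
  rw [this, map_zero]

/-- `T` is additive-to-multiplicative. -/
theorem soloBlindOB_T_add (a b : Fin r → ZMod 3) :
    soloBlindOBT r (a + b) = soloBlindOBT r a * soloBlindOBT r b := by
  unfold soloBlindOBT
  rw [ofAdd_add, map_mul]

/-- `T 0 = 1`. -/
theorem soloBlindOB_T_zero : soloBlindOBT r 0 = 1 := by
  unfold soloBlindOBT
  rw [ofAdd_zero, map_one]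

/-- `T` turns sums into products. -/
theorem soloBlindOB_T_sum {ι : Type*} (s : Finset ι) (f : ι → Fin r → ZMod 3) :
    soloBlindOBT r (∑ i ∈ s, f i) = ∏ i ∈ s, soloBlindOBT r (f i) := by
  classical
  induction s using Finset.induction_on with
  | empty => simp [soloBlindOB_T_zero]
  | insert j s hj ih => rw [sum_insert hj, prod_insert hj, soloBlindOB_T_add, ih]

/-- The coefficient of `T a` at `τ`. -/
theorem soloBlindOB_T_apply (a τ : Fin r → ZMod 3) :
    (soloBlindOBT r a).coeff (Multiplicative.ofAdd τ) = if a = τ then 1 else 0 := by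
  classical
  unfold soloBlindOBT
  rw [MonoidAlgebra.of_apply, MonoidAlgebra.coeff_single, Finsupp.single_apply]
  simp only [Equiv.apply_eq_iff_eq]

/-- The coefficient of `N` at every `τ` is `1`. -/
theorem soloBlindOB_norm_apply (τ : Fin r → ZMod 3) :
    (soloBlindOBNorm r).coeff (Multiplicative.ofAdd τ) = 1 := by
  classical
  unfold soloBlindOBNorm
  rw [MonoidAlgebra.coeff_sum, Finsupp.finsetSum_apply]
  simp_rw [soloBlindOB_T_apply]
  rw [Finset.sum_ite_eq' univ τ]
  simp

/-- `Y i ^ 3 = 0` (characteristic `3` and `[eᵢ]^3 = 1`). -/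
theorem soloBlindOB_Y_cube (i : Fin r) : soloBlindOBY i ^ 3 = 0 := by
  have h3 := (soloBlindOB_three_eq_zero (r := r))
  set t := soloBlindOBT r (Pi.single i 1) with ht
  have t3 : t ^ 3 = 1 := by
    have hsum : (Pi.single i 1 : Fin r → ZMod 3) + Pi.single i 1 + Pi.single i 1 = 0 := by
      funext j
      simp only [Pi.add_apply, Pi.zero_apply]
      generalize (Pi.single i (1 : ZMod 3) : Fin r → ZMod 3) j = x
      revert x; decide
    calc t ^ 3 = t * t * t := by ring
      _ = soloBlindOBT r (Pi.single i 1 + Pi.single i 1 + Pi.single i 1) := by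
          rw [soloBlindOB_T_add, soloBlindOB_T_add]
      _ = 1 := by rw [hsum, soloBlindOB_T_zero]
  unfold soloBlindOBY
  rw [← ht]
  linear_combination (-1 : SoloBlindOBAlg r) * t3 + (t ^ 2 - t) * h3

/-- `Y i ^ 2 = 1 + [eᵢ] + [eᵢ]^2`. -/
theorem soloBlindOB_Y_sq (i : Fin r) :
    soloBlindOBY i ^ 2 = 1 + soloBlindOBT r (Pi.single i 1) + soloBlindOBT r (Pi.single i 1) ^ 2 := by
  have h3 := (soloBlindOB_three_eq_zero (r := r))
  unfold soloBlindOBY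
  linear_combination (-(soloBlindOBT r (Pi.single i 1))) * h3

/-- The sum of `T` over one coordinate line: `Σ_{c ∈ 𝔽₃} [c eᵢ] = 1 + [eᵢ] + [eᵢ]^2`. -/
theorem soloBlindOB_sum_line (i : Fin r) :
    ∑ c : ZMod 3, soloBlindOBT r (Pi.single i c)
      = 1 + soloBlindOBT r (Pi.single i 1) + soloBlindOBT r (Pi.single i 1) ^ 2 := by
  have h2 : (Pi.single i (2 : ZMod 3) : Fin r → ZMod 3) = Pi.single i 1 + Pi.single i 1 := by
    rw [← Pi.single_add]; norm_num
  have : ∑ c : ZMod 3, soloBlindOBT r (Pi.single i c)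
      = soloBlindOBT r (Pi.single i 0) + soloBlindOBT r (Pi.single i 1)
        + soloBlindOBT r (Pi.single i 2) := Fin.sum_univ_three _
  rw [this, Pi.single_zero, soloBlindOB_T_zero, h2, soloBlindOB_T_add, sq]

/-- `∏ i, Y i ^ 2 = N`: the top monomial of the augmentation ideal is the norm element. -/
theorem soloBlindOB_prod_Y_sq : ∏ i : Fin r, soloBlindOBY i ^ 2 = soloBlindOBNorm r := by
  classical
  simp_rw [soloBlindOB_Y_sq, ← soloBlindOB_sum_line]
  rw [Finset.prod_univ_sum]
  simp only [Fintype.piFinset_univ]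
  unfold soloBlindOBNorm
  refine Finset.sum_congr rfl fun φ _ => ?_
  rw [← soloBlindOB_T_sum, Finset.univ_sum_single]

/-- Translation invariance of the norm element. -/
theorem soloBlindOB_T_mul_norm (a : Fin r → ZMod 3) :
    soloBlindOBT r a * soloBlindOBNorm r = soloBlindOBNorm r := by
  unfold soloBlindOBNorm
  rw [Finset.mul_sum]
  simp_rw [← soloBlindOB_T_add]
  exact Equiv.sum_comp (Equiv.addLeft a) (soloBlindOBT r)

/-- Every element of the group algebra acts on `N` by a scalar (its augmentation). -/
theorem soloBlindOB_mul_norm (u : SoloBlindOBAlg r) :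
    ∃ c : ZMod 3, u * soloBlindOBNorm r = c • soloBlindOBNorm r := by
  induction u using MonoidAlgebra.induction_on with
  | hM g =>
      refine ⟨1, ?_⟩
      rw [one_smul]
      have : MonoidAlgebra.of (ZMod 3) (Multiplicative (Fin r → ZMod 3)) g
          = soloBlindOBT r (Multiplicative.toAdd g) := by
        unfold soloBlindOBT; rw [ofAdd_toAdd]
      rw [this, soloBlindOB_T_mul_norm]
  | hadd f g hf hg =>
      obtain ⟨c, hc⟩ := hf
      obtain ⟨d, hd⟩ := hg
      exact ⟨c + d, by rw [add_mul, hc, hd, add_smul]⟩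
  | hsmul s f hf =>
      obtain ⟨c, hc⟩ := hf
      exact ⟨s * c, by rw [smul_mul_assoc, hc, smul_smul]⟩

/-- The ideal `J` spanned by the generators `Y i` (it is the augmentation ideal). -/
noncomputable def soloBlindOBJ (r : ℕ) : Ideal (SoloBlindOBAlg r) :=
  Ideal.span (Set.range (soloBlindOBY (r := r)))

/-- `1 - [c eᵢ] ∈ J` for every scalar `c`. -/
theorem soloBlindOB_one_sub_T_single_mem (i : Fin r) (c : ZMod 3) :
    1 - soloBlindOBT r (Pi.single i c) ∈ soloBlindOBJ r := by
  have hY : soloBlindOBY i ∈ soloBlindOBJ r := Ideal.subset_span ⟨i, rfl⟩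
  have h0 : 1 - soloBlindOBT r (Pi.single i (0 : ZMod 3)) ∈ soloBlindOBJ r := by
    rw [Pi.single_zero, soloBlindOB_T_zero, sub_self]; exact (soloBlindOBJ r).zero_mem
  have h1 : 1 - soloBlindOBT r (Pi.single i (1 : ZMod 3)) ∈ soloBlindOBJ r := hY
  have h2 : 1 - soloBlindOBT r (Pi.single i (2 : ZMod 3)) ∈ soloBlindOBJ r := by
    have e2 : (Pi.single i (2 : ZMod 3) : Fin r → ZMod 3) = Pi.single i 1 + Pi.single i 1 := by
      rw [← Pi.single_add]; norm_num
    rw [e2, soloBlindOB_T_add]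
    have : (1 : SoloBlindOBAlg r) - soloBlindOBT r (Pi.single i 1) * soloBlindOBT r (Pi.single i 1)
        = soloBlindOBY i * (1 + soloBlindOBT r (Pi.single i 1)) := by
      unfold soloBlindOBY; ring
    rw [this]
    exact (soloBlindOBJ r).mul_mem_right _ hY
  have hc : c = 0 ∨ c = 1 ∨ c = 2 := by revert c; decide
  rcases hc with h | h | h <;> subst h <;> assumption

/-- If each `1 - z i` lies in an ideal, so does `1 - ∏ z i`. -/
theorem soloBlindOB_one_sub_prod_mem {ι : Type*} (I : Ideal (SoloBlindOBAlg r)) (s : Finset ι)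
    (z : ι → SoloBlindOBAlg r) (h : ∀ i ∈ s, 1 - z i ∈ I) : 1 - ∏ i ∈ s, z i ∈ I := by
  classical
  induction s using Finset.induction_on with
  | empty => simp
  | insert j s hj ih =>
      rw [prod_insert hj]
      have e : (1 : SoloBlindOBAlg r) - z j * ∏ i ∈ s, z i
          = (1 - z j) * ∏ i ∈ s, z i + (1 - ∏ i ∈ s, z i) := by ring
      rw [e]
      exact I.add_mem (I.mul_mem_right _ (h j (mem_insert_self j s)))
        (ih fun i hi => h i (mem_insert_of_mem hi))

/-- Every `1 - [a]` lies in `J` (so `J` is the augmentation ideal). -/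
theorem soloBlindOB_one_sub_T_mem (a : Fin r → ZMod 3) :
    1 - soloBlindOBT r a ∈ soloBlindOBJ r := by
  have ha : soloBlindOBT r a = ∏ i, soloBlindOBT r (Pi.single i (a i)) := by
    rw [← soloBlindOB_T_sum, Finset.univ_sum_single]
  rw [ha]
  exact soloBlindOB_one_sub_prod_mem _ _ _ fun i _ => soloBlindOB_one_sub_T_single_mem i (a i)

/-- A product of generators regrouped by exponents. -/
theorem soloBlindOB_prod_Y_fibres {m : ℕ} (ι : Fin m → Fin r) :
    ∏ k, soloBlindOBY (ι k)
      = ∏ i : Fin r, soloBlindOBY i ^ (univ.filter fun k => ι k = i).card := by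
  classical
  rw [← Finset.prod_fiberwise_of_maps_to (s := univ) (t := univ) (g := ι) (fun k _ => mem_univ _)]
  refine Finset.prod_congr rfl fun i _ => ?_
  rw [← Finset.prod_const]
  refine Finset.prod_congr rfl fun k hk => ?_
  rw [(mem_filter.1 hk).2]

/-- The exponents of a product of `m` generators add up to `m`. -/
theorem soloBlindOB_sum_fibres {m : ℕ} (ι : Fin m → Fin r) :
    ∑ i : Fin r, (univ.filter fun k => ι k = i).card = m := by
  classical
  rw [← Finset.card_eq_sum_card_fiberwise (s := univ) (t := univ) (f := ι) fun k _ => mem_univ _]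
  simp

/-- If some generator occurs at least three times, the product vanishes. -/
theorem soloBlindOB_prod_Y_eq_zero_of_three {m : ℕ} (ι : Fin m → Fin r) (i : Fin r)
    (hi : 3 ≤ (univ.filter fun k => ι k = i).card) : ∏ k, soloBlindOBY (ι k) = 0 := by
  classical
  rw [soloBlindOB_prod_Y_fibres]
  exact Finset.prod_eq_zero (mem_univ i) (pow_eq_zero_of_le hi (soloBlindOB_Y_cube i))

/-- PIGEONHOLE I: a product of at least `2r + 1` generators vanishes (`J^(2r+1) = 0`). -/
theorem soloBlindOB_prod_Y_eq_zero {m : ℕ} (hm : 2 * r + 1 ≤ m) (ι : Fin m → Fin r) :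
    ∏ k, soloBlindOBY (ι k) = 0 := by
  classical
  by_cases h : ∃ i, 3 ≤ (univ.filter fun k => ι k = i).card
  · obtain ⟨i, hi⟩ := h
    exact soloBlindOB_prod_Y_eq_zero_of_three ι i hi
  · push Not at h
    have hle : ∑ i : Fin r, (univ.filter fun k => ι k = i).card ≤ ∑ _i : Fin r, 2 :=
      Finset.sum_le_sum fun i _ => Nat.lt_succ_iff.mp (h i)
    rw [soloBlindOB_sum_fibres, sum_const, card_univ, Fintype.card_fin, smul_eq_mul] at hle
    omega

/-- PIGEONHOLE II: a product of exactly `2r` generators is `0` or the norm element `N`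
(`J^(2r) = 𝔽₃ · N`). -/
theorem soloBlindOB_prod_Y_of_eq {m : ℕ} (hm : m = 2 * r) (ι : Fin m → Fin r) :
    ∏ k, soloBlindOBY (ι k) = 0 ∨ ∏ k, soloBlindOBY (ι k) = soloBlindOBNorm r := by
  classical
  by_cases h : ∃ i, 3 ≤ (univ.filter fun k => ι k = i).card
  · obtain ⟨i, hi⟩ := h
    exact Or.inl (soloBlindOB_prod_Y_eq_zero_of_three ι i hi)
  · push Not at h
    right
    have hle : ∀ i ∈ (univ : Finset (Fin r)), (univ.filter fun k => ι k = i).card ≤ 2 :=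
      fun i _ => Nat.lt_succ_iff.mp (h i)
    have hsum : ∑ i : Fin r, (univ.filter fun k => ι k = i).card = ∑ _i : Fin r, 2 := by
      rw [soloBlindOB_sum_fibres, sum_const, card_univ, Fintype.card_fin, smul_eq_mul]; omega
    have hall := (Finset.sum_eq_sum_iff_of_le hle).1 hsum
    rw [soloBlindOB_prod_Y_fibres, ← soloBlindOB_prod_Y_sq]
    exact Finset.prod_congr rfl fun i hi => by rw [hall i hi]

/-- Expansion of Olson's element over the generators: if `m ≥ 2r + 1` then `∏ (1 - [a k]) = 0`. -/
theorem soloBlindOB_olson_prod_eq_zero {m : ℕ} (hm : 2 * r + 1 ≤ m) (a : Fin m → Fin r → ZMod 3) :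
    ∏ k, (1 - soloBlindOBT r (a k)) = 0 := by
  classical
  have hq : ∀ k, ∃ q : Fin r → SoloBlindOBAlg r, ∑ i, q i * soloBlindOBY i = 1 - soloBlindOBT r (a k) :=
    fun k => Ideal.mem_span_range_iff_exists_fun.1 (soloBlindOB_one_sub_T_mem (a k))
  choose q hq using hq
  simp_rw [← hq]
  rw [Finset.prod_univ_sum]
  refine Finset.sum_eq_zero fun ι _ => ?_
  rw [Finset.prod_mul_distrib, soloBlindOB_prod_Y_eq_zero hm ι, mul_zero]

/-- Expansion of Olson's element over the generators: if `m = 2r` then `∏ (1 - [a k]) = c · N`. -/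
theorem soloBlindOB_olson_prod_eq_smul {m : ℕ} (hm : m = 2 * r) (a : Fin m → Fin r → ZMod 3) :
    ∃ c : ZMod 3, ∏ k, (1 - soloBlindOBT r (a k)) = c • soloBlindOBNorm r := by
  classical
  have hq : ∀ k, ∃ q : Fin r → SoloBlindOBAlg r, ∑ i, q i * soloBlindOBY i = 1 - soloBlindOBT r (a k) :=
    fun k => Ideal.mem_span_range_iff_exists_fun.1 (soloBlindOB_one_sub_T_mem (a k))
  choose q hq using hq
  simp_rw [← hq]
  rw [Finset.prod_univ_sum]
  have hterm : ∀ ι : Fin m → Fin r, ∃ c : ZMod 3,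
      ∏ k, (q k (ι k) * soloBlindOBY (ι k)) = c • soloBlindOBNorm r := by
    intro ι
    rw [Finset.prod_mul_distrib]
    rcases soloBlindOB_prod_Y_of_eq hm ι with h | h
    · exact ⟨0, by rw [h, mul_zero, zero_smul]⟩
    · rw [h]; exact soloBlindOB_mul_norm _
  choose c hc using hterm
  refine ⟨∑ ι ∈ Fintype.piFinset fun _ : Fin m => (univ : Finset (Fin r)), c ι, ?_⟩
  rw [Finset.sum_smul]
  exact Finset.sum_congr rfl fun ι _ => hc ι


end OlsonBerman

end Summit.MatrixMultiplication.MatrixMultiplication.Theorems
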